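import Summits.PneNP.GCT.MultObstructionPer3Det4
import Summits.PneNP.GCT.SufficesForValiant
import Literature.Computability.AlgebraicComplexity.PerDetHwvCertificateDetDeficit
import Literature.Barriers.ValiantsHypothesis.GCTOccurrenceObstructions
import HarnessLib

/-!
# BIP corpus — «what would suffice» chain for rung V3 (val-lit cell, D-0074 GROUP L)

Honest framing. `VP ≠ VNP` is NOT proved here or anywhere in the tree. This file is a
sorry-free chain of implications, every OPEN link a hypothesis binder, ending in the EXISTING
rung declarations `Summit.PneNP.GCT.MultObstructionPer3Det4` (item stmt-ValiantsHypothesis-19612,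
route `ValiantsHypothesis/GCTMult`) and, through `Summit.PneNP.GCT.SufficesForVPneVNP`
(`sufficesForVPneVNP_holds`), in the summit constant `ValiantsHypothesis`. The instance
`(per₃, det₄)` is METHOD VALIDATION at a KNOWN separation — `dc̄(per₃) ≥ 5`
(Landsberg–Manivel–Ressayre 2013) — not progress on the separation itself. No new conjecture,
no new named fact and no axiom is introduced: every hypothesis below is a `Prop` already defined
in the tree, and every conclusion is an existing declaration.

What each typed source of the BIP corpus contributes, as a link (cell files `bip/README.md`,
`bip/GAP-LEDGER-rows.md`):

* Mulmuley–Sohoni GCT I/II — the framework: an obstruction (a highest weight whose multiplicity in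
  `ℂ[Δ(X₀₀^{m-n} per_n)]` exceeds that in `ℂ[Δ(det_m)]`) forces `X₀₀^{m-n} per_n ∉ Δ(det_m)`, hence
  `dc(per_n) > m` (tree: `not_hasBorderDetRepr_of_perDetMultiplicityObstruction`,
  `lt_determinantalComplexity_perPoly_of_perDetMultiplicityObstruction`); families of obstructions
  in the quasi-polynomial window give the summit (`sufficesForVPneVNP_holds`). Links (e), (f).
* BLMW 2011 §5.2 — the det-side ceiling `mult_{λ*} ℂ[Δ(det_m)]_d ≤ sk(λ, m×d)`
  (`orbitMultiplicity_det_le_symKroneckerCoeffRect`, PROVED): a symmetric-Kronecker obstruction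
  suffices. Links (a), (e).
* Ikenmeyer–Panova 2017 Thm. 1.3 — the Kronecker form `g(λ, m×d, m×d) < mult_per-side`
  (`PerDetKroneckerObstructionAt`). Link (b). (Their Main Theorem and BIP 2019 Thm. 1.4 exclude only
  the OCCURRENCE versions — det-side multiplicity `0` — and only in the range `n ≥ m^25`
  (`GCTOccurrenceObstructions_holds`); the multiplicity versions used here are open.)
* Dörfler–Ikenmeyer–Panova 2020 §5 / Ikenmeyer–Kandasamy 2020 — two-sided highest-weight-vector
  bounds: a per-side LOWER bound `L` (evaluation rank; kernel-checkable certificates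
  `TableauEval.Cert`, `Cert.le_orbitMultiplicity`) and a det-side UPPER bound `U` with `U < L`.
  Links (c), (d).
* Bürgisser–Ikenmeyer 2017 / Bürgisser 2024 §7.4 — which weights can carry obstructions at all
  (polystability, fundamental invariants; `GCTUsefulModules`): constraints on the search, no link.

## Main results (all elementary compositions of tree theorems)
* `multObstructionPer3Det4_of_symKronecker` (a), `multObstructionPer3Det4_of_kronecker` (b),
  `multObstructionPer3Det4_of_bounds` (c), `multObstructionPer3Det4_of_cert_detDeficit` (d):
  four hypothesis shapes, each closing the rung `MultObstructionPer3Det4`.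
* `multObstructionsBeyondQuasiPoly_of_symKroneckerFamily` (e) and
  `valiantsHypothesis_of_symKroneckerFamily` (f): the family version through
  `MultObstructionsBeyondQuasiPoly` to `ValiantsHypothesis`;
  `dcPerSuperpolynomial_of_symKroneckerPolyFamily` the `VBP ≠ VNP` (dc-language) analogue.
* `multObstructionPer3Det4_outside_bip_range`: bookkeeping — `(3, 4)` lies OUTSIDE the range
  `n ≥ m^25` of the BIP no-go theorem (`4 < 3^25`), so at this rung even an occurrence obstruction
  is not excluded by `GCTOccurrenceObstructions`.

## References
* K. Mulmuley, M. Sohoni, *GCT I*, SIAM J. Comput. 31 (2001), Prop. 4.4, Conj. 4.3; *GCT II*,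
  SIAM J. Comput. 38 (2008) = arXiv:cs/0612134, §1 Defs. 1.2–1.3.
* P. Bürgisser, J. M. Landsberg, L. Manivel, J. Weyman, SIAM J. Comput. 40 (2011) =
  arXiv:0907.2850v3, §5.2 Prop. 5.2.1, (5.2.5)–(5.2.7).
* C. Ikenmeyer, G. Panova, Adv. Math. 319 (2017) = arXiv:1512.03798, Thm. 1.3.
* P. Bürgisser, C. Ikenmeyer, G. Panova, J. AMS 32 (2019) = arXiv:1604.06431, Thm. 1.4, §1.1.
* J. Dörfler, C. Ikenmeyer, G. Panova, SIAM J. Appl. Algebra Geom. 4 (2020) = arXiv:1901.04576, §5.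
* C. Ikenmeyer, U. Kandasamy, STOC 2020 = arXiv:1911.03990, Thm. 4.2.
* J. M. Landsberg, L. Manivel, N. Ressayre, *Hypersurfaces with degenerate duals and the geometric
  complexity theory program*, Comment. Math. Helv. 88 (2013), Thm. 1.0.3 (`dc̄(per₃) = 5`).
-/

noncomputable section

namespace Summit.ValiantsHypothesis.BIPWhatWouldSuffice

open Literature.Computability.AlgebraicComplexity Literature.NumberTheory.DiophantineGeometry
open Summit.PneNP.GCT

/-! ### (a)–(d): four hypothesis shapes closing the rung `MultObstructionPer3Det4` -/

/-- **(a) BLMW (5.2.5)-route at `(3, 4)`**: a symmetric-Kronecker obstruction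
`sk(λ, 4×d) < mult_{λ*} ℂ[Δ(X₀₀ per₃)]_d` at some `(d, λ)` closes the rung, because
`mult_{λ*} ℂ[Δ(det₄)]_d ≤ sk(λ, 4×d)` (`orbitMultiplicity_det_le_symKroneckerCoeffRect`, PROVED).
The hypothesis is OPEN. [cite: BLMW2011, §5.2 Prop. 5.2.1] -/
theorem multObstructionPer3Det4_of_symKronecker {d : ℕ} {lam : Nat.Partition (4 * d)}
    (h : PerDetSymKroneckerObstructionAt (k := ℂ) 3 4 d lam) : MultObstructionPer3Det4 :=
  multObstructionPer3Det4_of_at h.perDetMultiplicityObstructionAt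

/-- **(b) Ikenmeyer–Panova Kronecker route at `(3, 4)`**: `g(λ, 4×d, 4×d) < mult_{λ*} ℂ[Δ(X₀₀ per₃)]_d`
at some `(d, λ)` closes the rung (`g ≥ sk ≥ mult_det`). The hypothesis is OPEN; Ikenmeyer–Panova's
Main Theorem excludes only its occurrence version (`g = 0`). [cite: IkenmeyerPanova2017, Thm. 1.3] -/
theorem multObstructionPer3Det4_of_kronecker {d : ℕ} {lam : Nat.Partition (4 * d)}
    (h : PerDetKroneckerObstructionAt (k := ℂ) 3 4 d lam) : MultObstructionPer3Det4 :=
  multObstructionPer3Det4_of_at h.perDetMultiplicityObstructionAt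

/-- **(c) Two-sided bound shape (DIP 2020 §5 / IK 2020)**: a det₄-side UPPER bound `U`, a padded-per₃-side
LOWER bound `L` at the same highest weight `χ`, and `U < L`, close the rung. Both bounds are the
open links; the tree supplies per-side lower bounds by kernel-checked HWV evaluation
(`TableauEval.Cert.le_orbitMultiplicity`) and det-side upper bounds `≤ sk`, `≤ a_λ(d[4]) − rank`
(`orbitMultiplicity_det_le_symKroneckerCoeffRect`, `orbitMultiplicity_le_plethysmCoeff_sub_finrank`).
[cite: DorflerIkenmeyerPanova2020, §5] -/
theorem multObstructionPer3Det4_of_bounds (χ : Weight (MatIdx 4)) (U L : ℕ)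
    (hU : orbitMultiplicity ℂ (detFormLex ℂ 4) 4 χ ≤ U)
    (hL : L ≤ orbitMultiplicity ℂ (paddedPerFormLex ℂ 3 4) 4 χ) (hUL : U < L) :
    MultObstructionPer3Det4 :=
  multObstructionPer3Det4_iff.mpr ⟨χ, lt_of_le_of_lt hU (lt_of_lt_of_le hUL hL)⟩

/-- Transport of a certificate-coordinate obstruction to the literal rung coordinates `(3, 4)`.
[folklore] -/
theorem multObstructionPer3Det4_of_at_eq {n m : ℕ} [NeZero m] (hn : n = 3) (hm : m = 4) {d : ℕ}
    {lam : Nat.Partition (m * d)} (h : PerDetMultiplicityObstructionAt (k := ℂ) n m d lam) :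
    MultObstructionPer3Det4 := by
  subst hn; subst hm
  exact multObstructionPer3Det4_of_at h

/-- **(d) Certificate shape (the GCT engines' target)**: a kernel-verified canonical per-side
certificate `c` with `(c.n, c.m) = (3, 4)` (`c.r ≤ mult_{λ*} ℂ[Δ(X₀₀ per₃)]_{c.d}`) together with the
det₄-side DEFICIT `mult_{λ*} ℂ[Δ(det₄)]_{c.d} < c.r` closes the rung
(`TableauEval.Cert.perDetMultiplicityObstructionAt_of_det_lt`, p402653). The deficit inequality is
the open link. [cite: DorflerIkenmeyerPanova2020, §5] -/
theorem multObstructionPer3Det4_of_cert_detDeficit (c : TableauEval.Cert) [NeZero c.m]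
    (hn : c.n = 3) (hm : c.m = 4) (h : c.verify = true) (hcan : c.canonical = true)
    (hdet : orbitMultiplicity ℂ (detFormLex ℂ c.m) c.m
      (c.weight (c.lam_pos_of_verify h) (c.lam_sum_of_verify h)) < c.r) :
    MultObstructionPer3Det4 :=
  multObstructionPer3Det4_of_at_eq hn hm (c.perDetMultiplicityObstructionAt_of_det_lt h hcan hdet)

/-! ### (e)–(f): families in the quasi-polynomial window ⇒ the summit constant -/

/-- **(e) Family version, symmetric-Kronecker form**: obstructions `sk < mult_per-side` at
`(m, n)` with `n ≥ 2^{(log m + c)^c}` for every `c` give `MultObstructionsBeyondQuasiPoly`.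
OPEN hypothesis (this is the multiplicity form of the Mulmuley–Sohoni programme in BLMW's
rendering; no instance with `m ≥ 3` is known). [cite: BLMW2011, §5.2 Prop. 5.2.1] -/
theorem multObstructionsBeyondQuasiPoly_of_symKroneckerFamily
    (h : ∀ c : ℕ, ∃ (m n : ℕ) (_ : NeZero n) (d : ℕ) (lam : Nat.Partition (n * d)),
      2 ^ ((Nat.log 2 m + c) ^ c) ≤ n ∧ PerDetSymKroneckerObstructionAt (k := ℂ) m n d lam) :
    MultObstructionsBeyondQuasiPoly := by
  intro c
  obtain ⟨m, n, inst, d, lam, hle, hobs⟩ := h c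
  exact ⟨m, n, inst, _, hle, hobs.perDetMultiplicityObstructionAt.perDetMultiplicityObstruction⟩

/-- **(f) … and hence the summit constant** `ValiantsHypothesis` (`VP_ℂ ≠ VNP_ℂ`), through
`sufficesForVPneVNP_holds` (`MultObstructionsBeyondQuasiPoly → ValiantsHypothesis`, PROVED glue).
The hypothesis is OPEN and is the whole difficulty. [cite: MulmuleySohoniGCT2SIAM2008, §1] -/
theorem valiantsHypothesis_of_symKroneckerFamily
    (h : ∀ c : ℕ, ∃ (m n : ℕ) (_ : NeZero n) (d : ℕ) (lam : Nat.Partition (n * d)),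
      2 ^ ((Nat.log 2 m + c) ^ c) ≤ n ∧ PerDetSymKroneckerObstructionAt (k := ℂ) m n d lam) :
    ValiantsHypothesis :=
  sufficesForVPneVNP_holds (multObstructionsBeyondQuasiPoly_of_symKroneckerFamily h)

/-- **Family version in certificate coordinates** (any obstruction shape, weight found by an
engine as `(m, n, d, λ)`): `MultObstructionsBeyondQuasiPoly` from `PerDetMultiplicityObstructionAt`
witnesses in the quasi-polynomial window, hence `ValiantsHypothesis`. [folklore] -/
theorem valiantsHypothesis_of_obstructionAtFamily
    (h : ∀ c : ℕ, ∃ (m n : ℕ) (_ : NeZero n) (d : ℕ) (lam : Nat.Partition (n * d)),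
      2 ^ ((Nat.log 2 m + c) ^ c) ≤ n ∧ PerDetMultiplicityObstructionAt (k := ℂ) m n d lam) :
    ValiantsHypothesis := by
  refine sufficesForVPneVNP_holds ?_
  intro c
  obtain ⟨m, n, inst, d, lam, hle, hobs⟩ := h c
  exact ⟨m, n, inst, _, hle, hobs.perDetMultiplicityObstruction⟩

/-- **Polynomial window, dc-language** (`VBP ≠ VNP` reading): symmetric-Kronecker obstructions at
`(m, n)` with `n ≥ m^c + c` for every `c` give `DcPerSuperpolynomial ℂ` (`¬ IsPBounded (m ↦ dc per_m)`)
through `sufficesForVBPneVNP_holds`. OPEN hypothesis. [cite: BLMW2011, §5.2 Prop. 5.2.1] -/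
theorem dcPerSuperpolynomial_of_symKroneckerPolyFamily
    (h : ∀ c : ℕ, ∃ (m n : ℕ) (_ : NeZero n) (d : ℕ) (lam : Nat.Partition (n * d)),
      m ^ c + c ≤ n ∧ PerDetSymKroneckerObstructionAt (k := ℂ) m n d lam) :
    DcPerSuperpolynomial ℂ := by
  refine sufficesForVBPneVNP_holds ?_
  intro c
  obtain ⟨m, n, inst, d, lam, hle, hobs⟩ := h c
  exact ⟨m, n, inst, _, hle, hobs.perDetMultiplicityObstructionAt.perDetMultiplicityObstruction⟩

/-! ### Bookkeeping: where the rung sits relative to the BIP no-go range -/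

/-- `(per₃, det₄)` is OUTSIDE the range `m ≥ n^25` (`n` = permanent size) in which
Bürgisser–Ikenmeyer–Panova's Thm. 1.4 (`GCTOccurrenceObstructions`) excludes occurrence
obstructions: `4 < 3^25`. So the no-go theorem says nothing at this rung; it constrains only the
FAMILY links (e)/(f), where for `n ≥ m^25` every obstruction must have positive det-side
multiplicity. [cite: BurgisserIkenmeyerPanovaJAMS2019, Thm. 1.4] -/
theorem multObstructionPer3Det4_outside_bip_range : ¬ (3 ^ 25 ≤ 4) := by norm_num

/-- The rung implies the separation it validates against: `X₀₀ per₃ ∉ Δ(det₄)`, i.e.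
`¬ HasBorderDetRepr ℂ 3 4` (tree: `not_hasBorderDetRepr_of_multObstructionPer3Det4`), a KNOWN fact
(`dc̄(per₃) = 5`, Landsberg–Manivel–Ressayre 2013) — which is why the rung is method validation and
not a new lower bound. [cite: LandsbergManivelRessayre2013, Thm. 1.0.3] -/
theorem not_hasBorderDetRepr_three_four_of_rung (h : MultObstructionPer3Det4) :
    ¬ HasBorderDetRepr ℂ 3 4 :=
  not_hasBorderDetRepr_of_multObstructionPer3Det4 h

end Summit.ValiantsHypothesis.BIPWhatWouldSuffice
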